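import Mathlib
import Literature.NumberTheory.Transcendental.OkadaLinearIndependence
import HarnessLib

/-!
# Okada's theorem (Hurwitz-zeta form), I: the Bernoulli–Fourier identity and the character sums

Topic `Literature/NumberTheory/Transcendental`. Proofs-only companion (theorems only, no new definition,
no new fact) of `OkadaLinearIndependence.lean`, whose named fact `okada_linearIndependent_hurwitzZeta`
(Okada 1981 [Okada1981, Theorem], in the Hurwitz-zeta form of Gun–Murty–Rath [GunRammurtyRath2011,
Lemma 1 and eq. (2), proof of Thm. 1, p. 1332]: for `k ≥ 2`, `q ≥ 3` the `φ(q)/2` numbers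
`ζ(k, a/q) + (−1)^k ζ(k, 1 − a/q)`, `1 ≤ a < q/2`, `(a, q) = 1`, are `ℚ`-linearly independent) is
DISCHARGED in the sibling file `OkadaLinearIndependenceProofs.lean`. This file supplies the two analytic
identities of the printed route ("the proof in [GMR] uses the expansion of Bernoulli polynomials",
Chatterjee–Murty, *On the dimension of Chowla–Milnor space*, arXiv:1308.6445, p. 3), written in Mathlib's
vocabulary: `𝕖 = ZMod.stdAddChar` (`j ↦ e^{2πij/q}`), `H(r) = hurwitzZeta (ZMod.toAddCircle r) k`
(`= ζ(k, r/q)` for `1 ≤ r ≤ q − 1`), `B_k = bernoulliFun k` (the Bernoulli polynomial as a real function).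

* `hurwitz_symm_eq_bernoulli_sum` — for every `r : ZMod q`,
  `H(r) + (−1)^k H(−r) = q^{k−1} · (−(2πi)^k/k!) · Σ_{j : ZMod q} 𝕖(−jr) B_k(j/q)`:
  Mathlib's Fourier expansion of the periodised Bernoulli polynomial
  `Σ_{n≥1} (e(nx) + (−1)^k e(−nx))/n^k = −(2πi)^k B_k(x)/k!` (`hasSum_one_div_nat_pow_mul_fourier`,
  `0 ≤ x ≤ 1`, `k ≥ 2`) at `x = j/q`, filtered through the roots of unity
  (`Σ_j 𝕖(j(n − r)) = q·[n ≡ r]`, `AddChar.sum_mulShift`) and resummed by residue classes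
  (`Nat.sumByResidueClasses`, `hasSum_hurwitzZeta_of_one_lt_re`). In particular the left side is
  `(2πi)^k` times an element of `ℚ(e^{2πi/q})` — [GunRammurtyRath2011, eq. (2)] / Lai–Li 2025 (1.1).
* `sum_char_mul_hurwitz_symm` — for a Dirichlet character `χ` mod `q`,
  `Σ_r χ(r) (H(r) + (−1)^k H(−r)) = (1 + (−1)^k χ(−1)) q^k L(k, χ)`, read off from Mathlib's DEFINITION
  of the Dirichlet `L`-function as a combination of Hurwitz zeta functions (`ZMod.LFunction`), and
  `LFunction_nat_ne_zero` (`L(k, χ) ≠ 0` for `k ≥ 2`, Mathlib `DirichletCharacter.LFunction_ne_zero_of_one_le_re`).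
* `ofReal_hurwitz_symm` — the tree's real number `Σ_{n≥0} (n + a/q)^{−k} + (−1)^k Σ_{n≥0} (n + (1 − a/q))^{−k}`
  of the fact IS `H(a) + (−1)^k H(−a)` (`0 ≤ a ≤ q`).

Architecture of the discharge (five steps, (A)–(E); this file = (A) and (C)): (A) the Bernoulli–Fourier identity
above puts each `w(r) = H(r) + (−1)^k H(−r)` in `(2πi)^k ℚ(e^{2πi/q})`, explicitly; (B) [file II] a `ℚ`-relation
`Σ_a c_a w(a) = 0` is `P(ζ_q) = 0` for a rational polynomial `P`, so `P(ζ_q^t) = 0` for `(t, q) = 1` because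
`minpoly_ℚ ζ_q = Φ_q = minpoly_ℚ ζ_q^t` — the relation transports to `Σ_a c_a w(at) = 0`; (C) the character sums
`Σ_r χ(r) w(r) = (1 + (−1)^kχ(−1)) q^k L(k, χ)`, `L(k, χ) ≠ 0` (this file); (D) [file II] hence
`Σ_a c_a χ(a)⁻¹ = 0` whenever `χ(−1) = (−1)^k`, and summing `(1 + (−1)^kχ(−1))(Σ_a c_a χ(a)⁻¹)χ(b)` over all `χ`
(orthogonality) gives `φ(q)(c_b + (−1)^k c_{−b}) = 0`, i.e. `c_b = 0` on the half-system (no `a + a' ≡ 0`);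
(E) [file II] `linearIndependent_iff'`. Sources: [cite: Okada1981, Theorem];
[cite: GunRammurtyRath2011, Lemma 1 + eq. (2), p. 1332].

HONEST FRAMING (cells pub-zeta5 / zeta5-irr: systematic search; no irrationality claim unless kernel-certified):
classical identities for Hurwitz zeta values at rational points; nothing here concerns `ζ(5)`.
-/

noncomputable section

open Complex Real Set Finset HurwitzZeta

open scoped Nat

namespace Literature.NumberTheory.Transcendental.Okada

variable {q : ℕ} [NeZero q]

/-! ### The Fourier side: roots of unity and the periodised Bernoulli polynomial -/

/-- `e(n · j/q) = 𝕖(n j)` for the standard additive character `𝕖` of `ZMod q`. [folklore] -/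
private theorem fourier_nat_eq_stdAddChar (n : ℕ) (j : ZMod q) :
    fourier (n : ℤ) (((j.val : ℝ) / q : ℝ) : UnitAddCircle) = ZMod.stdAddChar ((n : ZMod q) * j) := by
  rw [fourier_coe_apply]
  have : ((n : ZMod q) * j) = (((n : ℤ) * (j.val : ℤ) : ℤ) : ZMod q) := by
    push_cast
    rw [ZMod.natCast_zmod_val]
  rw [this, ZMod.stdAddChar_coe]
  congr 1
  push_cast
  ring

/-- `e(−n · j/q) = 𝕖(−n j)`. [folklore] -/
private theorem fourier_neg_nat_eq_stdAddChar (n : ℕ) (j : ZMod q) :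
    fourier (-(n : ℤ)) (((j.val : ℝ) / q : ℝ) : UnitAddCircle) =
      ZMod.stdAddChar (-((n : ZMod q) * j)) := by
  rw [fourier_coe_apply]
  have : (-((n : ZMod q) * j)) = ((-((n : ℤ) * (j.val : ℤ)) : ℤ) : ZMod q) := by
    push_cast
    rw [ZMod.natCast_zmod_val]
  rw [this, ZMod.stdAddChar_coe]
  congr 1
  push_cast
  ring

/-- `0 ≤ j/q ≤ 1` for the least residue `j = j.val` of a class mod `q`. [folklore] -/
private theorem val_div_mem_Icc (j : ZMod q) : ((j.val : ℝ) / q : ℝ) ∈ Icc (0 : ℝ) 1 :=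
  ⟨by positivity, div_le_one_of_le₀ (by exact_mod_cast (ZMod.val_lt j).le) (by positivity)⟩

/-- The Fourier expansion of the Bernoulli polynomial at the rational point `x = j/q` (`k ≥ 2`):
`Σ_{n ≥ 1} (𝕖(nj) + (−1)^k 𝕖(−nj))/n^k = −(2πi)^k B_k(j/q)/k!` (Mathlib's `hasSum_one_div_nat_pow_mul_fourier`
with `e(± n j/q) = 𝕖(± nj)`). [cite: GunRammurtyRath2011, eq. (2) and proof of Thm. 1 (p. 1332)] -/
theorem hasSum_stdAddChar_div_pow_eq_bernoulli {k : ℕ} (hk : 2 ≤ k) (j : ZMod q) :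
    HasSum (fun n : ℕ => 1 / (n : ℂ) ^ k *
      (ZMod.stdAddChar ((n : ZMod q) * j) + (-1 : ℂ) ^ k * ZMod.stdAddChar (-((n : ZMod q) * j))))
      (-(2 * π * I) ^ k / k ! * bernoulliFun k ((j.val : ℝ) / q)) := by
  have := hasSum_one_div_nat_pow_mul_fourier hk (val_div_mem_Icc j)
  simp only [fourier_nat_eq_stdAddChar, fourier_neg_nat_eq_stdAddChar] at this
  exact this

/-- Orthogonality of the additive characters: `Σ_{j mod q} 𝕖(j b) = q·[b = 0]`. [folklore] -/
private theorem sum_stdAddChar_mul (b : ZMod q) :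
    ∑ j : ZMod q, ZMod.stdAddChar (j * b) = if b = 0 then (q : ℂ) else 0 := by
  rw [AddChar.sum_mulShift b (ZMod.isPrimitive_stdAddChar q), ZMod.card]
  split_ifs <;> simp

/-- The root-of-unity filter: `Σ_j 𝕖(−jr) · (𝕖(nj) + (−1)^k 𝕖(−nj))/n^k = q([n ≡ r] + (−1)^k [n ≡ −r])/n^k`.
[folklore] -/
private theorem sum_stdAddChar_filter (k : ℕ) (r : ZMod q) (n : ℕ) :
    ∑ j : ZMod q, ZMod.stdAddChar (-(j * r)) * (1 / (n : ℂ) ^ k *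
      (ZMod.stdAddChar ((n : ZMod q) * j) + (-1 : ℂ) ^ k * ZMod.stdAddChar (-((n : ZMod q) * j)))) =
    (q : ℂ) * ((if (n : ZMod q) = r then 1 / (n : ℂ) ^ k else 0) +
      (-1 : ℂ) ^ k * (if (n : ZMod q) = -r then 1 / (n : ℂ) ^ k else 0)) := by
  have h1 : ∀ j : ZMod q, ZMod.stdAddChar (-(j * r)) * ZMod.stdAddChar ((n : ZMod q) * j) =
      ZMod.stdAddChar (j * ((n : ZMod q) - r)) := by
    intro j
    rw [← AddChar.map_add_eq_mul]
    congr 1; ring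
  have h2 : ∀ j : ZMod q, ZMod.stdAddChar (-(j * r)) * ZMod.stdAddChar (-((n : ZMod q) * j)) =
      ZMod.stdAddChar (j * (-((n : ZMod q) + r))) := by
    intro j
    rw [← AddChar.map_add_eq_mul]
    congr 1; ring
  calc _ = 1 / (n : ℂ) ^ k *
          (∑ j : ZMod q, ZMod.stdAddChar (-(j * r)) * ZMod.stdAddChar ((n : ZMod q) * j))
        + (-1 : ℂ) ^ k * (1 / (n : ℂ) ^ k) *
          (∑ j : ZMod q, ZMod.stdAddChar (-(j * r)) * ZMod.stdAddChar (-((n : ZMod q) * j))) := by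
        rw [Finset.mul_sum, Finset.mul_sum, ← Finset.sum_add_distrib]
        refine Finset.sum_congr rfl fun j _ => ?_
        ring
    _ = _ := by
        simp only [h1, h2, sum_stdAddChar_mul, sub_eq_zero, neg_eq_zero]
        have e2 : ((n : ZMod q) + r = 0) ↔ ((n : ZMod q) = -r) := by
          constructor
          · intro h; linear_combination h
          · intro h; rw [h]; ring
        simp only [e2]
        split_ifs <;> ring

/-! ### The Hurwitz side: summing one residue class -/

omit [NeZero q] in
/-- The series `Σ_{n ≡ r (q)} n^{−k}` converges absolutely for `k ≥ 2`. [folklore] -/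
private theorem summable_residue_div_pow {k : ℕ} (hk : 2 ≤ k) (r : ZMod q) :
    Summable (fun n : ℕ => if (n : ZMod q) = r then 1 / (n : ℂ) ^ k else 0) := by
  have hs : Summable (fun n : ℕ => 1 / (n : ℝ) ^ k) := Real.summable_one_div_nat_pow.mpr (by omega)
  refine Summable.of_norm_bounded hs fun n => ?_
  split_ifs
  · rw [norm_div, norm_one, norm_pow, Complex.norm_natCast]
  · simp only [norm_zero]; positivity

/-- `Σ_{n ≥ 1, n ≡ r (q)} n^{−k} = q^{−k} ζ(k, r/q)` with `ζ(k, r/q) = hurwitzZeta (r/q) k`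
(for `r ≡ 0` both sides omit the term `n = 0`, as Mathlib's `1/0 = 0` convention does).
[cite: GunRammurtyRath2011, §1 (p. 1328), definition of ζ(s, x)] -/
theorem tsum_residue_div_pow {k : ℕ} (hk : 2 ≤ k) (r : ZMod q) :
    ∑' n : ℕ, (if (n : ZMod q) = r then 1 / (n : ℂ) ^ k else 0) =
      1 / (q : ℂ) ^ k * hurwitzZeta (ZMod.toAddCircle r) k := by
  rw [Nat.sumByResidueClasses (summable_residue_div_pow hk r) q]
  have hcast : ∀ (j : ZMod q) (m : ℕ), ((j.val + q * m : ℕ) : ZMod q) = j := by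
    intro j m
    push_cast
    simp
  simp only [hcast]
  rw [Finset.sum_eq_single r]
  · simp only [if_true]
    have hs : 1 < (k : ℂ).re := by simp; omega
    have hH := hasSum_hurwitzZeta_of_one_lt_re (val_div_mem_Icc r) hs
    rw [ZMod.toAddCircle_apply, ← hH.tsum_eq, ← tsum_mul_left]
    refine tsum_congr fun m => ?_
    rw [cpow_natCast]
    have hq : (q : ℂ) ≠ 0 := by exact_mod_cast NeZero.ne q
    push_cast
    rw [show ((r.val : ℂ) + (q : ℂ) * m) = q * ((m : ℂ) + (r.val : ℂ) / q) by field_simp; ring]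
    rw [mul_pow, one_div_mul_one_div]
  · intro j _ hj
    simp [hj]
  · intro h; exact absurd (Finset.mem_univ r) h

/-! ### The identity: `ζ(k, r/q) + (−1)^k ζ(k, −r/q) ∈ (2πi)^k ℚ(e^{2πi/q})`, explicitly -/

/-- **The Bernoulli–Fourier identity** (the computation behind [GunRammurtyRath2011, eq. (2)] and Lai–Li's
(1.1) `V_k^+(q) ⊂ (2πi)^k ℚ(e^{2πi/q})`): for `k ≥ 2` and every residue `r mod q`,
`ζ(k, r/q) + (−1)^k ζ(k, −r/q) = q^{k−1} · (−(2πi)^k/k!) · Σ_{j mod q} 𝕖(−jr) B_k(j/q)`,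
with `ζ(k, x) = hurwitzZeta x k` on `ℝ/ℤ`, `𝕖(m) = e^{2πim/q}`, `B_k` the Bernoulli polynomial and `j/q ∈ [0, 1)`
its least representative. [cite: GunRammurtyRath2011, eq. (2) and proof of Thm. 1 (p. 1332)] -/
theorem hurwitz_symm_eq_bernoulli_sum {k : ℕ} (hk : 2 ≤ k) (r : ZMod q) :
    hurwitzZeta (ZMod.toAddCircle r) k + (-1 : ℂ) ^ k * hurwitzZeta (ZMod.toAddCircle (-r)) k =
      (q : ℂ) ^ (k - 1) * (-(2 * π * I) ^ k / k !) *
        ∑ j : ZMod q, ZMod.stdAddChar (-(j * r)) * (bernoulliFun k ((j.val : ℝ) / q) : ℂ) := by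
  -- the filtered Fourier series, summed in two ways
  have hF : HasSum (fun n : ℕ => ∑ j : ZMod q, ZMod.stdAddChar (-(j * r)) * (1 / (n : ℂ) ^ k *
      (ZMod.stdAddChar ((n : ZMod q) * j) + (-1 : ℂ) ^ k * ZMod.stdAddChar (-((n : ZMod q) * j)))))
      (∑ j : ZMod q, ZMod.stdAddChar (-(j * r)) * (-(2 * π * I) ^ k / k ! * bernoulliFun k ((j.val : ℝ) / q))) :=
    hasSum_sum fun j _ => (hasSum_stdAddChar_div_pow_eq_bernoulli hk j).mul_left _
  have h1 := hF.tsum_eq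
  simp only [sum_stdAddChar_filter k r] at h1
  rw [tsum_mul_left, Summable.tsum_add (summable_residue_div_pow hk r)
      ((summable_residue_div_pow hk (-r)).mul_left _), tsum_mul_left,
    tsum_residue_div_pow hk r, tsum_residue_div_pow hk (-r)] at h1
  have hq : (q : ℂ) ≠ 0 := by exact_mod_cast NeZero.ne q
  have hqk : (q : ℂ) ^ k ≠ 0 := pow_ne_zero _ hq
  have hk1 : (q : ℂ) ^ k = (q : ℂ) ^ (k - 1) * q := by
    rw [← pow_succ, Nat.sub_add_cancel (by omega)]
  -- solve for the Hurwitz combination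
  have h2 : hurwitzZeta (ZMod.toAddCircle r) k + (-1 : ℂ) ^ k * hurwitzZeta (ZMod.toAddCircle (-r)) k =
      (q : ℂ) ^ k / q * ((q : ℂ) * (1 / (q : ℂ) ^ k * hurwitzZeta (ZMod.toAddCircle r) ↑k +
        (-1) ^ k * (1 / (q : ℂ) ^ k * hurwitzZeta (ZMod.toAddCircle (-r)) ↑k))) := by
    field_simp
  rw [h2, h1, hk1, mul_div_assoc, div_self hq, mul_one, Finset.mul_sum, Finset.mul_sum]
  refine Finset.sum_congr rfl fun j _ => ?_
  ring

/-! ### The tree's real numbers are these Hurwitz combinations -/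

/-- For `0 ≤ a ≤ q`: the real number `Σ_{n ≥ 0} (n + a/q)^{−k} + (−1)^k Σ_{n ≥ 0} (n + (1 − a/q))^{−k}` of the fact
`okada_linearIndependent_hurwitzZeta`, cast to `ℂ`, is `ζ(k, a/q) + (−1)^k ζ(k, −a/q)` in Mathlib's sense
(`1 − a/q ≡ −a/q` in `ℝ/ℤ`). [cite: GunRammurtyRath2011, §1 (p. 1328) and Lemma 1 (p. 1332)] -/
theorem ofReal_hurwitz_symm {k : ℕ} (hk : 2 ≤ k) {a : ℕ} (ha : a ≤ q) :
    (((∑' n : ℕ, 1 / ((n : ℝ) + (a : ℕ) / (q : ℝ)) ^ k) +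
        (-1 : ℝ) ^ k * ∑' n : ℕ, 1 / ((n : ℝ) + (1 - (a : ℕ) / (q : ℝ))) ^ k : ℝ) : ℂ) =
      hurwitzZeta (ZMod.toAddCircle (a : ZMod q)) k +
        (-1 : ℂ) ^ k * hurwitzZeta (ZMod.toAddCircle (-(a : ZMod q))) k := by
  have hs : 1 < (k : ℂ).re := by simp; omega
  have hq : (0 : ℝ) < q := by exact_mod_cast Nat.pos_of_ne_zero (NeZero.ne q)
  have hx : ((a : ℝ) / q : ℝ) ∈ Icc (0 : ℝ) 1 :=
    ⟨by positivity, div_le_one_of_le₀ (by exact_mod_cast ha) hq.le⟩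
  have hx' : (1 - (a : ℝ) / q : ℝ) ∈ Icc (0 : ℝ) 1 :=
    ⟨sub_nonneg.2 hx.2, by linarith [hx.1]⟩
  have hA : ZMod.toAddCircle (a : ZMod q) = (((a : ℝ) / q : ℝ) : UnitAddCircle) := by
    rw [ZMod.toAddCircle_natCast]
  have hB : ZMod.toAddCircle (-(a : ZMod q)) = ((1 - (a : ℝ) / q : ℝ) : UnitAddCircle) := by
    rw [map_neg, ZMod.toAddCircle_natCast, ← AddCircle.coe_neg,
      show (1 - (a : ℝ) / q : ℝ) = -((a : ℝ) / q) + 1 by ring, AddCircle.coe_add_period]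
  have h1 := (hasSum_hurwitzZeta_of_one_lt_re hx hs).tsum_eq
  have h2 := (hasSum_hurwitzZeta_of_one_lt_re hx' hs).tsum_eq
  rw [hA, hB, ← h1, ← h2]
  push_cast
  simp only [cpow_natCast]

/-! ### The character sums -/

/-- For a Dirichlet character `χ` mod `q` and any `k`: `Σ_r χ(r) ζ(k, r/q) = q^k L(k, χ)` — Mathlib's DEFINITION of
the Dirichlet `L`-function as a combination of Hurwitz zeta functions. [folklore] -/
private theorem sum_char_mul_hurwitz (χ : DirichletCharacter ℂ q) (k : ℕ) :
    ∑ r : ZMod q, χ r * hurwitzZeta (ZMod.toAddCircle r) k = (q : ℂ) ^ k * χ.LFunction k := by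
  rw [DirichletCharacter.LFunction, ZMod.LFunction, ← mul_assoc, cpow_neg, cpow_natCast,
    mul_inv_cancel₀ (pow_ne_zero _ (by exact_mod_cast NeZero.ne q)), one_mul]

/-- For a Dirichlet character `χ` mod `q`: `Σ_r χ(r) ζ(k, −r/q) = χ(−1) q^k L(k, χ)`. [folklore] -/
private theorem sum_char_mul_hurwitz_neg (χ : DirichletCharacter ℂ q) (k : ℕ) :
    ∑ r : ZMod q, χ r * hurwitzZeta (ZMod.toAddCircle (-r)) k = χ (-1) * ((q : ℂ) ^ k * χ.LFunction k) := by
  rw [← sum_char_mul_hurwitz χ k, Finset.mul_sum]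
  rw [← Equiv.sum_comp (Equiv.neg (ZMod q))]
  refine Finset.sum_congr rfl fun r _ => ?_
  simp only [Equiv.neg_apply, neg_neg]
  rw [show (-r : ZMod q) = (-1) * r by ring, map_mul, mul_assoc]

/-- **The character sums of the Hurwitz combinations**: for a Dirichlet character `χ` mod `q`,
`Σ_{r mod q} χ(r) (ζ(k, r/q) + (−1)^k ζ(k, −r/q)) = (1 + (−1)^k χ(−1)) q^k L(k, χ)`.
[cite: Okada1981, Theorem (proof)] -/
theorem sum_char_mul_hurwitz_symm (χ : DirichletCharacter ℂ q) (k : ℕ) :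
    ∑ r : ZMod q, χ r * (hurwitzZeta (ZMod.toAddCircle r) k +
        (-1 : ℂ) ^ k * hurwitzZeta (ZMod.toAddCircle (-r)) k) =
      (1 + (-1 : ℂ) ^ k * χ (-1)) * ((q : ℂ) ^ k * χ.LFunction k) := by
  simp only [mul_add, Finset.sum_add_distrib, mul_left_comm (χ _) ((-1 : ℂ) ^ k), ← Finset.mul_sum,
    sum_char_mul_hurwitz, sum_char_mul_hurwitz_neg]
  ring

/-- `L(k, χ) ≠ 0` for every Dirichlet character `χ` mod `q` and every integer `k ≥ 2` — the non-vanishing input of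
the printed proof (absolute convergence of the Euler product; Mathlib `DirichletCharacter.LFunction_ne_zero_of_one_le_re`).
[cite: Okada1981, Theorem (proof)] -/
theorem LFunction_nat_ne_zero (χ : DirichletCharacter ℂ q) {k : ℕ} (hk : 2 ≤ k) : χ.LFunction k ≠ 0 :=
  DirichletCharacter.LFunction_ne_zero_of_one_le_re χ
    (Or.inr (by exact_mod_cast (show k ≠ 1 by omega))) (by simp; omega)

end Literature.NumberTheory.Transcendental.Okada
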